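import Summits.QuantumFields.BalabanUV.T4Continuum.Support.NE7ClassFluxGradBoundGeneric
import Summits.QuantumFields.BalabanUV.T4Continuum.Support.NE7AllMinimisersSmallGeneric
import Summits.QuantumFields.BalabanUV.T4Continuum.Support.NE7EnergyClassPoincareGeneric
import Summits.QuantumFields.BalabanUV.T4Continuum.Support.NE7OpenOfMinimisation
import Summits.QuantumFields.BalabanUV.T4Continuum.Support.GaugeFieldPerturbation
import HarnessLib

/-!
# NE7AllMinimisersFluxGradGeneric — PORT MAP P3.7 (part 2∕2): gen 108's (c7) `NE7AllMinimisersFluxGradSU2.all_minimisers_fluxGrad_SU2` AT `d = 4`, ANY BLOCK SIZE `L ≥ 2`,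
# ANY `U(n)`, NO DISPLAYED HYPOTHESIS — (10) TYPE UP TO A LOGARITHM FOR EVERY CONSTRAINED MINIMISER OVER THE SMALL DATA: `∃ ε₀ > 0, ∀ 0 < ε ≤ ε₀, ∃ c ≥ 0, ∀ N ≥ 1, ∃ δ_V > 0`:
# for every datum `V` of the small data of radius `δ_V`, every level `k` and EVERY minimiser `U` of `sfClass 4 L N ε` at level `k` over `V`: `‖∇_U F(x; κ, π)‖ ≤ c·(1+k)∕(L^k)³` —
# the log-tolerant regularity hypothesis `hreg10` of the docked END at block size `L`

Cell `pub-balaban`, rung (B)+1 sub-cell t4, lineage `b2b-balaban-t4-ne7b-p1` (row NE7b OWNER + CRUX PROVER), generation 156 — PORT MAP item P3.7 of the road t4-ne7-p1 g109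
([NE7P1-G109-INBOX-3]; memo `t4/b2b-balaban-t4-ne7-p1-g109/ROAD-G109.md` §3, recipe `2 ↦ L`), claimed [NE7bP1-G156-INBOX-6].
THE ARGUMENT (gen 108's, verbatim).  Level `0`: `‖∇_U F‖ ≤ 2·sup‖F‖ ≤ 4ε` (`GaugeFieldPerturbation.norm_flux_le_of_smallField`, class radius `ε`).  Level `k+1`: every
minimiser over the small data is interior (the road's ✓ p810303 `NE7AllMinimisersSmallGeneric.all_minimisers_small_generic`: `SmallField U ((ε∕4)∕M²)`), hence TANGENT-CRITICAL
(gen 90's Fermat theorem `NE7OpenOfMinimisation.tanCritical_of_isMinimiser`, stated at every block size), hence part 1's class letter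
`NE7ClassFluxGradBoundGeneric.exists_classFluxGradConst_generic` applies: `‖∇_U F‖ ≤ C·ε·(2+k)∕M³`.  Its three displayed ε-lines are folded into `ε₀`: the level family by
✓ p807957 `classPackage` (radius `θ₀(L, card n)`), `ε ≤ 1∕50`, and `2·thetaLoc 4 L·ε ≤ 1` by `ε ≤ 1∕(2·thetaLoc 4 L + 1)`.  Constant `c = (C + 4)·ε`.
WHAT ([folklore]; 0 def, 0 sorry).  **`all_minimisers_fluxGrad_generic`** (`2 ≤ L`, any nonempty finite `n`; displayed above).
HONEST FRAMING (page 1): composition of landed kernel theorems (the road's generic (8)∀, gen 90's Fermat theorem, part 1, the class package); this is [Balaban1985Variational]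
Thm 1 (10)'s SHAPE WITH A LOGARITHM, proved for OUR constrained minimisers by OUR route, NOT Bałaban's (10) and NOT by his method; nothing of Bałaban's asserted as an axiom;
finite 4-torus; NOT NE3∕NE7 as spine nodes; row NE7b (`T4WeightBudget.RelWeightBound`) NOT PRINTED ∕ NOT PROVED; spine count = dagwriter∕referees' call; NOT infinite volume, NOT
mass gap, NOT BetaPertH, NOT Clay (continuum YM on T⁴ ⇐ BetaPertH ∧ nine spine estimates).
-/

set_option autoImplicit false

open scoped BigOperators Matrix Matrix.Norms.L2Operator
open NormedSpace Finset

namespace Summit.QuantumFields.BalabanUV.T4Continuum.NE7AllMinimisersFluxGradGeneric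

open Literature.MathematicalPhysics.QuantumFieldTheory.Balaban1983to89
open B7Prop1Explicit B7Prop2Explicit
open T4AveragingDeficitWall (IsUnitaryCfg IsSkewDir SmallField Ad covGrad flux)
open T4AveragingDeficitWallBoundary (IsPeriodicCfg periodBox)
open AveragingDeficitPeriodicCounting (IsPeriodicDir)
open AveragingDeficitTransport (norm_Ad_of_unitary)
open AveragingDeficitMultiLevelPrep (LevelSmall TangentIter)
open MinimalActionSandwich (IsMinimiser admissible)
open MinimalActionRate (sfClass)
open NE3RightInverseSolveLetters (thetaLoc thetaLoc_nonneg)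
open GaugeFieldPerturbation (norm_flux_le_of_smallField)
open NE7AllMinimisersSmallGeneric (all_minimisers_small_generic)
open NE7OpenOfMinimisation (tanCritical_of_isMinimiser)
open NE7ClassFluxGradBoundGeneric (exists_classFluxGradConst_generic)
open NE7EnergyClassPoincareGeneric (classPackage)

noncomputable section

variable {n : Type} [Fintype n] [DecidableEq n]

set_option maxHeartbeats 400000 in
/-- **(10) TYPE UP TO A LOGARITHM FOR EVERY CONSTRAINED MINIMISER OVER THE SMALL DATA, `d = 4`, ANY BLOCK SIZE `L ≥ 2`, ANY `U(n)`** (statement in the file header). [folklore] -/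
theorem all_minimisers_fluxGrad_generic [Nonempty n] {L : ℕ} (hL : 2 ≤ L) :
    ∃ ε₀ : ℝ, 0 < ε₀ ∧ ∀ ε : ℝ, 0 < ε → ε ≤ ε₀ → ∃ c : ℝ, 0 ≤ c ∧ ∀ (N : ℕ) [NeZero N], 1 ≤ N →
      ∃ δV : ℝ, 0 < δV ∧
        ∀ V ∈ {V : Site 4 → Fin 4 → (Matrix n n ℂ)ˣ | IsUnitaryCfg V ∧ IsPeriodicCfg V (N : ℤ) ∧ SmallField V δV},
        ∀ (k : ℕ) (U : Site 4 → Fin 4 → (Matrix n n ℂ)ˣ), IsMinimiser 4 (sfClass 4 L N ε) L N k V U →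
          ∀ (x : Site 4) (κ : Fin 4) (π : T4AveragingDeficitWall.Plane 4),
            ‖covGrad U (flux U) x κ π‖ ≤ c * (1 + (k : ℝ)) / ((L : ℝ) ^ k) ^ 3 := by
  haveI : NeZero L := ⟨by omega⟩
  have hL1 : 1 ≤ L := Nat.le_trans (by norm_num) hL
  obtain ⟨ε₁, hε₁, H1⟩ := all_minimisers_small_generic (n := n) hL
  obtain ⟨C, hC, H2⟩ := exists_classFluxGradConst_generic (n := n) hL
  obtain ⟨θ₀, CF, CE, hθ₀, -, -, -, -, -, hls, -, -⟩ := classPackage (n := n) (d := 4) (by norm_num) hL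
  have hθL : 0 ≤ thetaLoc 4 L := thetaLoc_nonneg 4 L
  have hθpos : 0 < 2 * thetaLoc 4 L + 1 := by linarith
  refine ⟨min ε₁ (min θ₀ (min (1 / 50) (1 / (2 * thetaLoc 4 L + 1)))),
    lt_min hε₁ (lt_min hθ₀ (lt_min (by norm_num) (by positivity))), ?_⟩
  intro ε hε hεle
  have hεε₁ : ε ≤ ε₁ := hεle.trans (min_le_left _ _)
  have hεθ₀ : ε ≤ θ₀ := hεle.trans ((min_le_right _ _).trans (min_le_left _ _))
  have hε50 : ε ≤ 1 / 50 := hεle.trans ((min_le_right _ _).trans ((min_le_right _ _).trans (min_le_left _ _)))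
  have hεθL : ε ≤ 1 / (2 * thetaLoc 4 L + 1) := hεle.trans ((min_le_right _ _).trans ((min_le_right _ _).trans (min_le_right _ _)))
  have hθline : 2 * thetaLoc 4 L * ε ≤ 1 := by
    have h1 : 2 * thetaLoc 4 L * ε ≤ 2 * thetaLoc 4 L * (1 / (2 * thetaLoc 4 L + 1)) := mul_le_mul_of_nonneg_left hεθL (by positivity)
    have h2 : 2 * thetaLoc 4 L * (1 / (2 * thetaLoc 4 L + 1)) ≤ 1 := by
      rw [← mul_div_assoc, mul_one, div_le_one hθpos]; linarith
    exact h1.trans h2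
  have hlsε : ∀ k : ℕ, LevelSmall 4 L k (ε / ((L : ℝ) ^ (k + 1)) ^ 2) := hls hε.le hεθ₀
  refine ⟨(C + 4) * ε, by positivity, fun N _ hN => ?_⟩
  obtain ⟨δV, hδV, Hsmall⟩ := H1 ε hε hεε₁ N hN
  refine ⟨δV, hδV, ?_⟩
  rintro V hV k U hmin x κ ⟨⟨μ, ν⟩, hμν⟩
  cases k with
  | zero =>
      -- level 0: the trivial bound `‖∇_U F‖ ≤ 2·sup‖F‖ ≤ 4ε`
      have hUu : IsUnitaryCfg U := hmin.mem.1.1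
      have hUx : SmallField U (ε / ((L : ℝ) ^ 0) ^ 2) := hmin.mem.1.2.2
      rw [pow_zero, one_pow, div_one] at hUx
      have hflux := norm_flux_le_of_smallField hUx (hε50.trans (by norm_num))
      have h1 : ‖covGrad U (flux U) x κ ⟨(μ, ν), hμν⟩‖ ≤ 2 * ε + 2 * ε := by
        unfold covGrad
        refine (norm_sub_le _ _).trans (add_le_add ?_ (hflux _))
        rw [norm_Ad_of_unitary (hUu x κ)]
        exact hflux _
      have e : (C + 4) * ε * (1 + ((0 : ℕ) : ℝ)) / ((L : ℝ) ^ 0) ^ 3 = C * ε + 4 * ε := by push_cast; ring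
      rw [e]
      nlinarith
  | succ j =>
      -- level `j+1`: interior ⟹ tangent-critical ⟹ the class letter
      have hUa := Hsmall V hV (j + 1) U hmin
      have ha0 : 0 ≤ (ε / 4) / ((L : ℝ) ^ (j + 1)) ^ 2 := by positivity
      have haε : (ε / 4) / ((L : ℝ) ^ (j + 1)) ^ 2 < ε / ((L : ℝ) ^ (j + 1)) ^ 2 :=
        div_lt_div_of_pos_right (by linarith) (by positivity)
      have hcrit := tanCritical_of_isMinimiser (d := 4) (L := L) hL1 hN hmin ha0 haε hUa (hlsε j)
      have h := H2 N ε hε hε50 hθline hlsε V j U hmin.mem hcrit x κ μ ν hμν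
      refine h.trans (div_le_div_of_nonneg_right ?_ (by positivity))
      have hkk : (0 : ℝ) ≤ 1 + ((j + 1 : ℕ) : ℝ) := by positivity
      nlinarith [mul_nonneg hε.le hkk]

end

end Summit.QuantumFields.BalabanUV.T4Continuum.NE7AllMinimisersFluxGradGeneric
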